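import Mathlib
import HarnessLib

/-!
# Barrier catalogue `QuantumAdvantage` — the Gold/Nyberg cube map `x ↦ x³` on `𝔽_{2ⁿ}` is almost perfect nonlinear and near-bent

Topic `Literature/Barriers/QuantumAdvantage` (D-0021). Summit statement:
`QuantumAdvantage := ∃ L, L ∈ BQP ∧ L ∉ BPP`.

One of six entries that file the PROVED bounds of the retired route `SymplecticPurity`
(`Summits/QuantumAdvantage/QuantumAdvantage/Theses/SymplecticPurity.lean`, closed `retired` on the
human ruling of 2026-08-16) as barrier items: `NoFreeFramePurityBound` (`symplecticPurityBound`),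
`NoFreeFrameGaussianBound` (`gaussianDegreeBound`), `NoFreeFrameSBoxSpectrum` (`graphStateSpectrum`),
`NoFreeFrameCubeAlmostBent` (this file, fact `cubeAlmostBent` — the finite-field INPUT of the explicit
witness), `NoFreeFrameCubeGraphFlat` (`cubeGraphFlat`), `NoFreeFrame` (`noFreeFrame`). The six files
are independent (no mutual imports).

BARRIER: technique_class := dequantisation arguments that bank on ALGEBRAICALLY SIMPLE data-loading
  maps — low-degree polynomial maps over `𝔽₂`, computed by `O(n²)` Toffoli gates — having a peaked
  differential or Walsh spectrum (hence, by the companion dictionary `graphStateSpectrum`, a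
  non-flat, compressible data state); this entry is the number-theoretic input that defeats that hope
  on the simplest quadratic example;
  blocks := the cube map on a field `K` with `2ⁿ` elements is (i) ALMOST PERFECT NONLINEAR — for
  `a ≠ 0` and every `b` the equation `(x + a)³ + x³ = b` has at most `2` solutions — and (ii)
  NEAR-BENT — for `β ≠ 0` and every `α`, `|Σ_x (−1)^{Tr(αx + βx³)}| ≤ 2·√2ⁿ` (`cubeAlmostBent`);
  with `graphStateSpectrum` this makes the data-loading state of `x ↦ x³` `2^{1−n/2}`-flat on `2n`
  qubits (`cubeGraphFlat`), the explicit family on which the free-frame road dies (`noFreeFrame`);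
  because := (i) in characteristic `2`, `(x + a)³ + x³ = a x² + a² x + a³` is a quadratic in `x`
  with at most two roots — the Gold exponent `3 = 2¹ + 1` is APN for every `n`
  [cite: Carlet2020, §11.5.2 (PDF p. 497: Gold APN functions, "the proof … is easy")] [cite: Nyberg1994];
  (ii) squaring the character sum and substituting `y = x + u` (`x³ + (x+u)³ = u x² + u² x + u³`)
  gives `|W|² = Σ_u (−1)^{Tr(αu + βu³)} Σ_x (−1)^{Tr(βu x² + βu² x)}`; the inner summand is an additive
  character of `x` (`Tr(c x²) = Tr(c^{1/2} x)`), trivial exactly when `β²u⁴ + βu = 0`, i.e. for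
  `u = 0` or `u³ = β⁻¹` — at most `4` values of `u` — so `|W|² ≤ 4·2ⁿ`; the exact Walsh spectrum of
  `Tr(wx³ + ux)` is `{0, ±2^{(n+1)/2}}` for odd `n` (Gold 1968: three-valued cross-correlation of
  maximal sequences [cite: Gold1968]) and `⊆ {0, ±2^{n/2}, ±2^{n/2+1}}` for even `n`
  [cite: Carlet2020, PDF pp. 222–223 (Walsh transform of tr_n(wx³ + ux), both parities)]; the
  non-degeneracy of the trace form behind the character-sum evaluation is Mathlib's
  `traceForm_nondegenerate` [folklore];
  evasions_known := none needed — this is an unconditional finite-field fact; its ROLE is evaded by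
  loading maps that are not APN / highly nonlinear (see `graphStateSpectrum`, `evasions_known`);
  scope_caveats := (i) `K` is any field with `Fintype.card K = 2ⁿ` carrying an `Algebra (ZMod 2) K`
  structure (it exists uniquely in characteristic `2`; the route's witness family uses
  `K = 𝔽₂[X]/(Φ_{3^{k+1}})`, `n = 2·3^k`); (ii) the bound `2·√2ⁿ` is uniform in the parity of `n`
  (attained for even `n`, off by `√2` for odd `n`); (iii) `n = 0` is vacuous (no field has one
  element);
  status := theorem — published mathematics [cite: Gold1968] [cite: Nyberg1994]
  [cite: Carlet2020, §11.5.2 and PDF pp. 222–223], MACHINE-CHECKED IN THIS TREE, Summits side: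
  `Summit.QuantumAdvantage.QuantumAdvantage.Theorems.SymplecticPurity.cubeAlmostBent_proof` (file
  `Summits/QuantumAdvantage/QuantumAdvantage/Theorems/SymplecticPurityCubeAlmostBent.lean`, 301
  lines, over Mathlib only, standard axioms) closed item stmt-QuantumAdvantage-9841 of route
  `SymplecticPurity`; typed below as a NAMED FACT only because `Literature` may not import `Summits`
  (CONVENTIONS §2): the body is token for token the route decl
  `Summit.QuantumAdvantage.QuantumAdvantage.Theses.SymplecticPurity.CubeAlmostBent` (definitionally
  equal, `Iff.rfl`, and discharged by `exact cubeAlmostBent_proof` in the filing planner's scratch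
  check, 2026-08-16), so the discharge of record is the ONE-LINE Summits-side
  `theorem cubeAlmostBent_holds : Literature.Barriers.QuantumAdvantage.cubeAlmostBent :=
  Summit.QuantumAdvantage.QuantumAdvantage.Theorems.SymplecticPurity.cubeAlmostBent_proof`; a
  literature-prover who prefers a `Literature`-native proof can port that file (it imports only
  Mathlib) — until then do not duplicate it.

## Contents

* `cubeAlmostBent` — THE FACT of this file (the only declaration): APN + near-bent for `x ↦ x³`.

## Design notes

* One named fact, no other declaration (D-0026 / `lint.fact-fanout`). Pure Mathlib vocabulary
  (`Field`, `Fintype`, `Algebra (ZMod 2) K`, `Algebra.trace`, `Real.sqrt`), verbatim the route decl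
  so that the tree theorem discharges it by `exact`; `open scoped Classical` supplies the decidability
  of the filter predicate exactly as in the route file.
* Not placed under `Literature/NumberTheory` or a Boolean-functions topic on purpose: the human ruling
  files the retired route's bounds together, as barrier items; a later librarian move is harmless
  (the name is what the companion entries cite).

## References

* [Gold1968] R. Gold, *Maximal recursive sequences with 3-valued recursive cross-correlation
  functions*, IEEE Trans. Inform. Theory 14 (1968) 154–156.
* [Nyberg1994] K. Nyberg, *Differentially uniform mappings for cryptography*, EUROCRYPT '93, LNCS 765
  (1994) 55–64 (power maps `x^{2^k+1}`).
* [Carlet2020] C. Carlet, *Boolean Functions for Cryptography and Coding Theory*, CUP 2021: §11.5.2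
  (PDF p. 497), PDF pp. 222–223. Read via `lit read book:carlet2020-boolean-functions-cryptography-coding-theory --pages 222-223 / 495-498`.
-/

namespace Literature.Barriers.QuantumAdvantage

open scoped BigOperators Classical

/-- **Gold/Nyberg: the cube map is APN and near-bent.** In every field `K` with `2ⁿ` elements (as a
`ZMod 2`-algebra): (i) for `a ≠ 0` and every `b`, `#{x : (x + a)³ + x³ = b} ≤ 2` (almost perfect
nonlinearity of the Gold exponent `3`); (ii) for `β ≠ 0` and every `α`,
`|Σ_x (−1)^{Tr(αx + βx³)}| ≤ 2·√2ⁿ` (near-bent components; exactly `2^{(n+1)/2}` or `0` for odd `n`).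
- technique_class: banking on algebraically simple (quadratic, Toffoli-cheap) data-loading maps
  having a peaked differential / Walsh spectrum
- blocks: that hope for `x ↦ x³`: with `graphStateSpectrum` its data state is `2^{1−n/2}`-flat
  (`cubeGraphFlat`), the explicit witness behind `noFreeFrame`
- because: `(x+a)³ + x³ = a x² + a² x + a³` is quadratic in characteristic `2`
  [cite: Carlet2020, §11.5.2 (PDF p. 497)] [cite: Nyberg1994]; squaring the Walsh sum leaves `≤ 4`
  non-vanishing inner sums (`β²u⁴ + βu = 0`), so `|W|² ≤ 4·2ⁿ` [cite: Gold1968]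
  [cite: Carlet2020, PDF pp. 222–223]
- evasions_known: none (unconditional); its role is evaded only by choosing non-APN / weakly
  nonlinear loading maps
- scope_caveats: bound uniform in the parity of `n` (tight for even `n`); any `Algebra (ZMod 2) K`
  structure
- status: theorem (published: [cite: Gold1968] [cite: Nyberg1994] [cite: Carlet2020, §11.5.2]),
  machine-checked in this tree as
  `Summit.QuantumAdvantage.QuantumAdvantage.Theorems.SymplecticPurity.cubeAlmostBent_proof` (item
  stmt-QuantumAdvantage-9841, route `SymplecticPurity`, retired 2026-08-16); named fact here only
  because `Literature` does not import `Summits` — body definitionally equal to the route decl,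
  discharge = the one-line Summits-side `cubeAlmostBent_holds := …cubeAlmostBent_proof`
[cite: Carlet2020, §11.5.2 (PDF p. 497) and PDF pp. 222–223] -/
def cubeAlmostBent : Prop :=
  ∀ (n : ℕ) (K : Type) [Field K] [Fintype K] [Algebra (ZMod 2) K], Fintype.card K = 2 ^ n →
    (∀ a : K, a ≠ 0 → ∀ b : K, (Finset.univ.filter fun x : K => (x + a) ^ 3 + x ^ 3 = b).card ≤ 2) ∧
    (∀ β : K, β ≠ 0 → ∀ α : K,
      |∑ x : K, (if Algebra.trace (ZMod 2) K (α * x + β * x ^ 3) = 0 then (1 : ℝ) else -1)| ≤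
        2 * Real.sqrt 2 ^ n)

end Literature.Barriers.QuantumAdvantage
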